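import Mathlib.Algebra.QuadraticAlgebra.Basic
import Mathlib.Algebra.Group.Even
import Mathlib.Tactic.Ring
import Mathlib.Tactic.NormNum
import HarnessLib

/-!
# Venture HSemireg — THEOREM 37-D (i) (isosceles second-kind forms with `d` odd are REACHED): the fixed-lattice form of `gψ`,
# `H|_{R′}[z] = 2a·N(z) + 3s·(2xy − y²)`, via `Tr(√−3·z²) = −3(2xy − y²)`, and its parity (ENGINE-W PROBE5 §37 (5)) — kernel algebra

HONEST FRAMING. Lean index of the computation cell `pub-hsemireg`, widening group ENGINE-W (code A, seat `engine-w-1`,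
gen 17). `ℤ[ω]` ARITHMETIC (`ℤ[ω] = QuadraticAlgebra ℤ (−1) (−1)`, `ω² = −1 − ω`, `star` = conjugation, `√−3 = 1 + 2ω = ⟨1,2⟩`) and
integer parity; no abelian variety, sheaf, `Ext` group, secant structure or semiregularity map is constructed; nothing here says
that HC, HC_CM or HC_AV holds. Theorems only (0 `def`, 0 named fact, 0 `sorry`). New namespace `IsoscelesReached`; companion of
`IsoscelesPairBlockParity.lean` (THEOREM 53 = 37-D (ii), the `d` EVEN half).

SOURCE (the cell's own result): `widen/ENGINE-W/out/probe5/PROBE5-STIZ-A.md` §37 (5) (v4.3, engine-w-1 g11), **THEOREM 37-D** as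
printed: «`H = [[a, s√−3],[−s√−3, a]]`, `gcd(a, s) = 1`, `d = a² − 3s²` … **(i) `d` ODD ⇒ reached at every target** (hand, via THEOREM
35-H): if `a` is even (`s` odd) `ψ` itself has type `(9, even)` (35-G); if `a` is odd (then `s` is even, as `d` is odd) the structure
`gψ: (z₁,z₂) ↦ (−z̄₂, −z̄₁)` has fixed lattice `R′ = {(z, −z̄)}` with **`H|_{R′} = 2a·N(z) + 3s(2xy − y²)`** (`z = x + yω`; `Tr_{K∕ℚ}(√−3·z²)
= −3(2xy − y²)`), EVEN when `s` is even, and likewise `adj H` on the dual side, so `Φ_{gψ}` has type `(9, even)` ⇒ SEED.» Convention: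
`H[v] = vᵀ H v̄ = a·v₁v̄₁ + q·v₁v̄₂ + q̄′·v₂v̄₁ + c·v₂v̄₂` with `q = s√−3`, second-row entry `−s√−3`, and `N(x + yω) = x² − xy + y²`,
`Tr(p + qω) = 2p − q`. What the kernel holds:

* §1 (`(1+2ω)² = −3` is the landed `Summit.Ventures.HSemireg.AntilinearKinds.sqrtNegThree_sq`, not restated), `star_sqrt_neg_three` (`conj √−3 = −√−3`), **`trace_sqrt_neg_three_mul_sq`** — for
  `z = x + yω`: `Tr(√−3·z²) = −3(2xy − y²)` (as the identity `w + w̄ = −3(2xy − y²)` in `ℤ[ω]`, `w = √−3 z²`).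
* §2 **`fixed_form_value`** — `H[(z, −z̄)] = 2a·N(z) + 3s·(2xy − y²)` for `H = [[a, s√−3],[−s√−3, a]]` (an identity in `ℤ[ω]` whose
  right side is a rational integer); `fixed_form_dual` — the same for `adj H = [[a, −s√−3],[s√−3, a]]` with `−3s` in place of `3s`.
* §3 **`fixed_form_even`** — `a` odd and `s` even ⟹ `2a·N(z) + 3s(2xy − y²)` is EVEN for all `x, y` («EVEN when `s` is even»), and
  `d_odd_cases` — `d = a² − 3s²` odd with `gcd` bookkeeping: `a` even ⇒ `s` odd, `a` odd ⇒ `s` even (parities from `d` odd).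
WHAT IS NOT HERE: types `(9, even)`, THEOREM 35-H ∕ 35-G, the lattices; THEOREM 37-D (i) as a statement about reachability.
-/

namespace Summit.Ventures.HSemireg.IsoscelesReached

open QuadraticAlgebra

/-! ## §1 `√−3 = 1 + 2ω` (its square `= −3`: `AntilinearKinds.sqrtNegThree_sq`, in tree) and the trace of `√−3·z²` -/

/-- `conj(√−3) = −√−3`. [kernel] -/
theorem star_sqrt_neg_three : star (⟨1, 2⟩ : QuadraticAlgebra ℤ (-1) (-1)) = -⟨1, 2⟩ := by
  ext <;> simp [star_mk]

/-- **«`Tr_{K∕ℚ}(√−3·z²) = −3(2xy − y²)`»** for `z = x + yω`: with `w = √−3·z²`, `w + w̄ = −3(2xy − y²)` (a rational integer in `ℤ[ω]`).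
[kernel] -/
theorem trace_sqrt_neg_three_mul_sq (x y : ℤ) :
    (⟨1, 2⟩ : QuadraticAlgebra ℤ (-1) (-1)) * (⟨x, y⟩ * ⟨x, y⟩) + star ((⟨1, 2⟩ : QuadraticAlgebra ℤ (-1) (-1)) * (⟨x, y⟩ * ⟨x, y⟩))
      = ((-3 * (2 * x * y - y * y) : ℤ) : QuadraticAlgebra ℤ (-1) (-1)) := by
  ext
  · simp [star_mk]; ring
  · simp [star_mk]

/-! ## §2 The fixed-lattice form of `gψ` -/

/-- **«`H|_{R′} = 2a·N(z) + 3s(2xy − y²)`»**: for `H = [[a, s√−3],[−s√−3, a]]` and the `gψ`-fixed vector `v = (z, −z̄)`, `z = x + yω`,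
`H[v] = a·zz̄ + (s√−3)·z·(−z̄)‾ + (−s√−3)·(−z̄)·z̄ + a·(−z̄)(−z̄)‾ = 2a(x² − xy + y²) + 3s(2xy − y²)`. [kernel] -/
theorem fixed_form_value (a s x y : ℤ) :
    (a : QuadraticAlgebra ℤ (-1) (-1)) * ⟨x, y⟩ * star (⟨x, y⟩ : QuadraticAlgebra ℤ (-1) (-1))
      + ((s : QuadraticAlgebra ℤ (-1) (-1)) * ⟨1, 2⟩) * ⟨x, y⟩ * star (-star (⟨x, y⟩ : QuadraticAlgebra ℤ (-1) (-1)))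
      + (-((s : QuadraticAlgebra ℤ (-1) (-1)) * ⟨1, 2⟩)) * (-star (⟨x, y⟩ : QuadraticAlgebra ℤ (-1) (-1))) * star (⟨x, y⟩ : QuadraticAlgebra ℤ (-1) (-1))
      + (a : QuadraticAlgebra ℤ (-1) (-1)) * (-star (⟨x, y⟩ : QuadraticAlgebra ℤ (-1) (-1))) * star (-star (⟨x, y⟩ : QuadraticAlgebra ℤ (-1) (-1)))
      = ((2 * a * (x * x - x * y + y * y) + 3 * s * (2 * x * y - y * y) : ℤ) : QuadraticAlgebra ℤ (-1) (-1)) := by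
  ext <;> simp [star_mk] <;> ring

/-- «likewise `adj H` on the dual side»: for `adj H = [[a, −s√−3],[s√−3, a]]` the same vector gives `2a·N(z) − 3s(2xy − y²)`. [kernel] -/
theorem fixed_form_dual (a s x y : ℤ) :
    (a : QuadraticAlgebra ℤ (-1) (-1)) * ⟨x, y⟩ * star (⟨x, y⟩ : QuadraticAlgebra ℤ (-1) (-1))
      + (-((s : QuadraticAlgebra ℤ (-1) (-1)) * ⟨1, 2⟩)) * ⟨x, y⟩ * star (-star (⟨x, y⟩ : QuadraticAlgebra ℤ (-1) (-1)))
      + ((s : QuadraticAlgebra ℤ (-1) (-1)) * ⟨1, 2⟩) * (-star (⟨x, y⟩ : QuadraticAlgebra ℤ (-1) (-1))) * star (⟨x, y⟩ : QuadraticAlgebra ℤ (-1) (-1))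
      + (a : QuadraticAlgebra ℤ (-1) (-1)) * (-star (⟨x, y⟩ : QuadraticAlgebra ℤ (-1) (-1))) * star (-star (⟨x, y⟩ : QuadraticAlgebra ℤ (-1) (-1)))
      = ((2 * a * (x * x - x * y + y * y) - 3 * s * (2 * x * y - y * y) : ℤ) : QuadraticAlgebra ℤ (-1) (-1)) := by
  ext <;> simp [star_mk] <;> ring

/-! ## §3 Parity -/

/-- **«EVEN when `s` is even»**: for `s` even (the case `a` odd, `d` odd) the fixed form `2a·N(z) + 3s(2xy − y²)` takes only EVEN values —
so `Φ_{gψ}` has type `(9, even)`; the same for the dual side. [kernel] -/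
theorem fixed_form_even (a s x y : ℤ) (hs : Even s) :
    Even (2 * a * (x ^ 2 - x * y + y ^ 2) + 3 * s * (2 * x * y - y ^ 2)) ∧
      Even (2 * a * (x ^ 2 - x * y + y ^ 2) - 3 * s * (2 * x * y - y ^ 2)) := by
  obtain ⟨k, rfl⟩ := hs
  exact ⟨⟨a * (x ^ 2 - x * y + y ^ 2) + 3 * k * (2 * x * y - y ^ 2), by ring⟩,
    ⟨a * (x ^ 2 - x * y + y ^ 2) - 3 * k * (2 * x * y - y ^ 2), by ring⟩⟩

/-- The case split of 37-D (i): `d = a² − 3s²` odd forces exactly one of `a, s` to be odd — `a` even ⇒ `s` odd (then `ψ` itself is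
even-type, 35-G), `a` odd ⇒ `s` even (then `gψ`, `fixed_form_even`). [kernel] -/
theorem d_odd_cases (a s : ℤ) (hd : Odd (a ^ 2 - 3 * s ^ 2)) : (Even a ∧ Odd s) ∨ (Odd a ∧ Even s) := by
  rcases Int.even_or_odd a with ha | ha <;> rcases Int.even_or_odd s with hs | hs
  · exfalso
    obtain ⟨p, rfl⟩ := ha; obtain ⟨q, rfl⟩ := hs
    have he : Even ((p + p) ^ 2 - 3 * (q + q) ^ 2) := ⟨2 * p ^ 2 - 6 * q ^ 2, by ring⟩
    exact (Int.not_even_iff_odd.2 hd) he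
  · exact Or.inl ⟨ha, hs⟩
  · exact Or.inr ⟨ha, hs⟩
  · exfalso
    obtain ⟨p, rfl⟩ := ha; obtain ⟨q, rfl⟩ := hs
    have he : Even ((2 * p + 1) ^ 2 - 3 * (2 * q + 1) ^ 2) := ⟨2 * p ^ 2 + 2 * p - 6 * q ^ 2 - 6 * q - 1, by ring⟩
    exact (Int.not_even_iff_odd.2 hd) he

end Summit.Ventures.HSemireg.IsoscelesReached
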